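import Summits.CriticalPhenomena.PercolationContinuityZ3.Theorems.Transplant.PlanarSkeletonNeg1
import Summits.CriticalPhenomena.PercolationContinuityZ3.Theorems.Transplant.PlanarSkeletonCriticalProbLtOne
import HarnessLib

/-!
# The node variant D″(κ′): `PlanarSkeletonNegFrom` = the one-type `{±1}` interface with (κ) weakened to "cylinders connected FROM SOME
# WIDTH `ℓ₀` ON", and the drop node `SamePDropOfSkeletonNegFrom₁` over it (`@[conjecture]`, OPEN, never asserted)

builds on p205010 (kernel theorem, internal audit signed; external expert review pending) — nothing in this file uses p205010; NOTHING is claimed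
about the node (it is OPEN).  Lane `prim-bschramm`, seat `prim-bschramm-p4` gen 12 (PART C3: INPUT(G) as weak as possible); helper file
(`--supports stmt-CriticalPhenomena-4575 --as helper`).  DEFINITIONS + immediate reductions only.

WHY (P4-GENERAL §33.1/§33.5/§34.4).  The closed `{±1}` node `samePDropOfSkeletonNeg₁_holds` (p329520) asks (κ): the cylinder of EVERY half-width
`ℓ ≥ 1` at the base vertex is connected.  On a Cayley graph this is "`C_1` connected", which FAILS for the letters-only Cayley graphs of the free
nilpotent groups `N_{m,c}`, `c ≥ 4` (the box-1 kernel loops generate a rank-4 subgroup of `γ₂ ≅ ℤ^{≥ 6}`; GAP certificate j157698), although for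
them SOME cylinder is connected (finitely generated kernel) and Φ2 at `p_c` is ALREADY a theorem for every width (thick frames,
`CylData₂.theta_cyl_criticalProb_eq_zeroE`).  §34.4 shows that neither re-coordinatisation with standard symmetries nor `p_c`-preserving graph
surgery can manufacture (κ); the census §33.5 records that the node's proof consumes (κ) at four places, all at free or large widths.  Hence the
ONE remaining Cayley-side input of this lineage is the interface field itself, and this file types its weakening:
* `PlanarSkeletonNegFrom G` — `PlanarSkeletonNeg` verbatim except a width `ℓ₀ : ℕ` and (κ′) `cyl_connected : ∀ t ∈ types, ∀ ℓ ≥ ℓ₀, …`;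
  `cyl`, `CylSubcritical` verbatim; `PlanarSkeletonNeg.toNegFrom` (`ℓ₀ = 1`); `isQuasiTransitive`, `criticalProb_lt_one` (frames / steps only);
* **`SamePDropOfSkeletonNegFrom₁`** (OPEN): the one-type `{±1}` drop node over (κ′); `samePDropOfSkeletonNeg₁_of_negFrom₁` (it implies the
  closed node's statement — the converse is the open content); normal form `…_iff_critical`; `continuity_of_negFromNode₁` (the customers'
  one-liner: one type, `G` connected, Φ2 at `p_c` ⟹ `θ_t(p_c) = 0`, uniqueness by the Hutchcroft / Burton–Keane split, `p_c < 1` by the steps).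
CUSTOMERS (file `CayleySkeletonFrom`, conditional on this node): every `Cay(Γ;S)` with an additive unit-range skeleton, ONE reversing automorphism
and a finitely generated kernel — in particular the letters-only `N_{m+2,c+1}` of EVERY class.
[cite: KozmaNitzan2024, §1 p. 2 (approach 1); §4 pp. 15–17 (Lemma 8, the role of the lattice symmetries)] [cite: BenjaminiSchramm1996, Conj. 4]
-/

noncomputable section

namespace Summit.CriticalPhenomena.PercolationContinuityZ3.Theorems.Transplant

open MeasureTheory Literature.Probability.Percolation Literature.Probability.LatticeModels
open Literature.Barriers.CriticalPhenomena (IsQuasiTransitive IsGraphAmenable HasExponentialGrowth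
  hasExponentialGrowth_of_not_isGraphAmenable Hutchcroft2016_noPercolationAtCriticality_holds BurtonKeane1989_atMostOneInfiniteCluster_holds
  countable_of_connected_of_locallyFinite)
open scoped Classical

/-- **Planar skeleton with the central inversion and cylinders connected FROM SOME WIDTH ON** (interface of the node variant D″(κ′)):
`PlanarSkeletonNeg` with (κ) replaced by (κ′) `∃ ℓ₀, ∀ ℓ ≥ ℓ₀, cylinders connected` (the width is a field). [cite: KozmaNitzan2024, §4 p. 16 (Lemma 8)] -/
structure PlanarSkeletonNegFrom {V : Type} (G : SimpleGraph V) [G.LocallyFinite] where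
  /-- the skeleton map `φ : V → ℤ²` -/
  φ : V → Site 2
  /-- `φ` is 1-Lipschitz in the sup-norm along edges -/
  lip : ∀ ⦃u v : V⦄, G.Adj u v → ∀ i : Fin 2, |φ u i - φ v i| ≤ 1
  /-- finitely many base vertices (one per frame type) -/
  types : Finset V
  /-- FRAMES: every vertex is the image of a base vertex under an automorphism translating the skeleton -/
  frame : ∀ v : V, ∃ t ∈ types, ∃ α : G ≃g G, α t = v ∧ ∀ w, φ (α w) = φ w + (φ v - φ t)
  /-- THE CENTRAL INVERSION: at each base vertex an automorphism fixing it and reversing the relative skeleton coordinate -/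
  neg : ∀ t ∈ types, ∃ α : G ≃g G, α t = t ∧ ∀ w, φ (α w) - φ t = -(φ w - φ t)
  /-- (μ) a degree bound -/
  Δ : ℕ
  /-- every vertex has degree `≤ Δ` -/
  degree_le : ∀ v : V, G.degree v ≤ Δ
  /-- (ι) outward unit steps in every skeleton direction at every vertex -/
  step : ∀ (v : V) (i : Fin 2) (σ : ℤˣ), ∃ v' : V, G.Adj v v' ∧ φ v' = φ v + Pi.single i (σ : ℤ)
  /-- (κ′) the width from which on cylinders are connected -/
  ℓ₀ : ℕ
  /-- (κ′) the graph induced on each cylinder of half-width `ℓ ≥ ℓ₀` at a base vertex is connected -/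
  cyl_connected : ∀ t ∈ types, ∀ ℓ : ℕ, ℓ₀ ≤ ℓ → (G.induce {w | φ w - φ t ∈ box 2 ℓ}).Connected

namespace PlanarSkeletonNegFrom

variable {V : Type} {G : SimpleGraph V} [G.LocallyFinite] (Φ : PlanarSkeletonNegFrom G)

/-- Cylinder of half-width `ℓ` at `t`. [cite: KozmaNitzan2024, §4 p. 15 (boxes)] -/
def cyl (t : V) (ℓ : ℕ) : Set V := {w | Φ.φ w - Φ.φ t ∈ box 2 ℓ}

/-- **Input Φ2 at density `p`**: the induced graph of every cylinder (EVERY width) at a base vertex has `θ = 0` at `p`.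
[cite: MartineauSevero2019, Cor. 2.2] -/
def CylSubcritical (p : unitInterval) : Prop :=
  ∀ t ∈ Φ.types, ∀ ℓ : ℕ,
    theta (G.induce (Φ.cyl t ℓ)) ⟨t, show Φ.φ t - Φ.φ t ∈ box 2 ℓ by rw [sub_self]; exact zero_mem_box 2 ℓ⟩ p = 0

include Φ in
/-- Frames with finitely many types make `G` quasi-transitive. [cite: Hutchcroft2016, §1 (finitely many Aut(G)-orbits)] -/
theorem isQuasiTransitive : IsQuasiTransitive G := by
  refine ⟨Φ.types, fun v => ?_⟩
  obtain ⟨t, ht, α, hαt, -⟩ := Φ.frame v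
  exact ⟨α.symm, by rw [← hαt, RelIso.symm_apply_apply]; exact ht⟩

include Φ in
/-- `p_c < 1` at every vertex of a connected `PlanarSkeletonNegFrom` graph (from the steps alone). [cite: BenjaminiSchramm1996, Thm. 1] -/
theorem criticalProb_lt_one (hc : G.Connected) (t : V) : criticalProb G t < 1 :=
  haveI : Countable V := countable_of_connected_of_locallyFinite G hc t
  Skelφ.criticalProb_lt_one_of_steps (φ := Φ.φ) Φ.step t

end PlanarSkeletonNegFrom

namespace PlanarSkeletonNeg

variable {V : Type} {G : SimpleGraph V} [G.LocallyFinite] (Φ : PlanarSkeletonNeg G)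

/-- **Every `PlanarSkeletonNeg` is a `PlanarSkeletonNegFrom`** with `ℓ₀ = 1`. [folklore] -/
def toNegFrom : PlanarSkeletonNegFrom G where
  φ := Φ.φ
  lip := Φ.lip
  types := Φ.types
  frame := Φ.frame
  neg := Φ.neg
  Δ := Φ.Δ
  degree_le := Φ.degree_le
  step := Φ.step
  ℓ₀ := 1
  cyl_connected := Φ.cyl_connected

/-- The base vertices of `toNegFrom` are those of the skeleton. [folklore] -/
@[simp] theorem toNegFrom_types : Φ.toNegFrom.types = Φ.types := rfl

/-- The cylinders of `toNegFrom` are those of the skeleton. [folklore] -/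
@[simp] theorem toNegFrom_cyl (t : V) (ℓ : ℕ) : Φ.toNegFrom.cyl t ℓ = Φ.cyl t ℓ := rfl

/-- Cylinder subcriticality is the same statement for `toNegFrom`. [folklore] -/
theorem cylSubcritical_toNegFrom_iff (p : unitInterval) : Φ.toNegFrom.CylSubcritical p ↔ Φ.CylSubcritical p := Iff.rfl

end PlanarSkeletonNeg

/-- TARGET (OPEN — a `Prop`, never asserted; NOT in print): **THE NODE VARIANT D″(κ′)** — the one-type `{±1}` drop node over skeletons whose
cylinders are connected only from some width `ℓ₀` on.  For every connected, locally finite, countable `G` with a `PlanarSkeletonNegFrom` having ONE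
base vertex type `t`, every `p < 1` with a.s. uniqueness, subcritical cylinders and `θ_t(p) > 0` there is `q < p` with `θ_t(q) > 0`.  It implies the
closed node's statement `SamePDropOfSkeletonNeg₁` (`samePDropOfSkeletonNeg₁_of_negFrom₁`); the converse is its open content.  Intended proof: the
N1 closure (`SkelNeg1HoldsAllL`) re-run with every consumed cylinder width raised to `max(·, ℓ₀)` (census P4-GENERAL §33.5: four consumers, all at
free or large widths). [cite: KozmaNitzan2024, §1 p. 2 (approach 1), §4 pp. 15–31] [cite: BenjaminiSchramm1996, Conj. 4] -/
@[conjecture] def SamePDropOfSkeletonNegFrom₁ : Prop :=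
  ∀ {V : Type} [DecidableEq V] [Countable V] (G : SimpleGraph V) [G.LocallyFinite] (Φ : PlanarSkeletonNegFrom G),
    G.Connected → ∀ t ∈ Φ.types, Φ.types = {t} → ∀ p : unitInterval, (p : ℝ) < 1 →
      (∀ᵐ ω ∂bondPercolation G p, numInfiniteClusters ω ≤ 1) → Φ.CylSubcritical p → 0 < theta G t p →
        ∃ q : unitInterval, (q : ℝ) < p ∧ 0 < theta G t q

/-- **The node variant D″(κ′) implies the (closed) one-type `{±1}` node's statement** (forget that `ℓ₀ = 1`). [folklore] -/
theorem samePDropOfSkeletonNeg₁_of_negFrom₁ (h : SamePDropOfSkeletonNegFrom₁) : SamePDropOfSkeletonNeg₁ :=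
  fun G _ Φ hc t ht h1 p hp hU hC hθ => h G Φ.toNegFrom hc t (by rwa [PlanarSkeletonNeg.toNegFrom_types])
    (by rw [PlanarSkeletonNeg.toNegFrom_types, h1]) p hp hU ((PlanarSkeletonNeg.cylSubcritical_toNegFrom_iff Φ p).2 hC) hθ

/-- **Normal form at criticality**: the node variant has content at `p = p_c` only. [cite: BenjaminiSchramm1996, Conj. 4] -/
theorem samePDropOfSkeletonNegFrom₁_iff_critical : SamePDropOfSkeletonNegFrom₁ ↔
    ∀ {V : Type} [DecidableEq V] [Countable V] (G : SimpleGraph V) [G.LocallyFinite] (Φ : PlanarSkeletonNegFrom G),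
      G.Connected → ∀ t ∈ Φ.types, Φ.types = {t} → criticalProb G t < 1 →
        (∀ᵐ ω ∂bondPercolation G (criticalProbIOf G t), numInfiniteClusters ω ≤ 1) →
          Φ.CylSubcritical (criticalProbIOf G t) → theta G t (criticalProbIOf G t) = 0 := by
  constructor
  · intro hD V _ _ G _ Φ hc t ht h1 hpc hU hC
    exact theta_criticalProbIOf_eq_zero_of_drop_at G t fun hpos => hD G Φ hc t ht h1 _ (by exact hpc) hU hC hpos
  · intro hK V _ _ G _ Φ hc t ht h1 p hp1 hU hC hθ
    have hge : criticalProb G t ≤ p :=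
      not_lt.1 fun hlt => hθ.ne' (theta_eq_zero_of_lt_criticalProb_holds G t p hlt)
    rcases hge.lt_or_eq with hlt | heq
    · have hpc0 : 0 ≤ criticalProb G t := (criticalProb_mem_Icc G t).1
      have hp0 : 0 ≤ (p : ℝ) := p.2.1
      have hq1 : (criticalProb G t + p) / 2 ≤ 1 := by linarith [p.2.2]
      refine ⟨⟨(criticalProb G t + p) / 2, by positivity, hq1⟩, ?_, ?_⟩
      · show (criticalProb G t + (p : ℝ)) / 2 < p
        linarith
      · exact theta_pos_of_criticalProb_lt_holds G t _
          (by show criticalProb G t < (criticalProb G t + (p : ℝ)) / 2; linarith)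
    · exfalso
      have e : p = criticalProbIOf G t := Subtype.ext heq.symm
      subst e
      exact hθ.ne' (hK G Φ hc t ht h1 (by exact hp1) hU hC)

/-- **Conditional continuity from the node variant D″(κ′)** (the customers' one-liner): on a connected locally finite graph with a one-type
`PlanarSkeletonNegFrom` and subcritical cylinders at `p_c`, `θ_t(p_c) = 0` — countability, quasi-transitivity, uniqueness (Hutchcroft off amenability,
Burton–Keane on it) and `p_c < 1` come from the skeleton. [cite: BenjaminiSchramm1996, Conj. 4] [cite: Hutchcroft2016, Thm. 1] [cite: LyonsPeres2016, Thm. 7.6] -/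
theorem continuity_of_negFromNode₁ (hD : SamePDropOfSkeletonNegFrom₁) {V : Type} (G : SimpleGraph V) [G.LocallyFinite]
    (Φ : PlanarSkeletonNegFrom G) (hc : G.Connected) (t : V) (ht : t ∈ Φ.types) (h1 : Φ.types = {t})
    (hC : Φ.CylSubcritical (criticalProbIOf G t)) : theta G t (criticalProbIOf G t) = 0 := by
  haveI : Countable V := countable_of_connected_of_locallyFinite G hc t
  have hq : IsQuasiTransitive G := Φ.isQuasiTransitive
  by_cases hg : HasExponentialGrowth G
  · exact Hutchcroft2016_noPercolationAtCriticality_holds G hc hq hg t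
  · have ha : IsGraphAmenable G := by_contra fun hna => hg (hasExponentialGrowth_of_not_isGraphAmenable G hq hna)
    exact samePDropOfSkeletonNegFrom₁_iff_critical.1 hD G Φ hc t ht h1 (Φ.criticalProb_lt_one hc t)
      (BurtonKeane1989_atMostOneInfiniteCluster_holds G hc hq ha _) hC

end Summit.CriticalPhenomena.PercolationContinuityZ3.Theorems.Transplant

end
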